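import Summits.Ventures.CertifiedArithmetic.LowPrec.DoubleRoundingProductRegisterDecision

/-!
# Double rounding of products — the closed form is SOUND for every source (THEOREM D-mul-R⁺)

HONEST FRAMING: certified error envelopes and provably optimal rounding/accumulation schemes for
low-precision formats under stated cost models; every table by two implementations; no hardware
or vendor claims.

`DoubleRoundingProductRegisterDecision.lean` decides `DRMul φ ψ` (ONE product of `φ`-data
computed in an embedded register `ψ` at least as precise, round-to-nearest-even twice) by the
closed form `mulRegisterTest φ ψ` under the hypothesis `mulRegisterHyp` — the source is DEEP
(`bias ≥ m + 3`) with HEADROOM (`2^(m+bias+1) ≤ M_φ`) and `bias_ψ ≥ 1`.  Those side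
conditions serve only the NEGATIVE half.  This file records the positive half with the
hypotheses it really needs:

* §1 THEOREM D-mul-R⁺ (`drMul_of_mulRegisterTest`, record-generic): for EVERY pair of records
  with `F_φ ⊆ F_ψ`, `m ≥ 1` and one normal binade in the source (`2^m ≤ M_φ`),
  `mulRegisterTest φ ψ = true → DRMul φ ψ` — no depth, no headroom, no `bias_ψ` clause.  It
  is the join of the four sufficient parts as they stand in the tree: equal precision and equal
  quanta (`drMul_of_equal_precision_sameQ`), the equal-quantum strip at `m ≤ 2`
  (`drMul_sameQ_strip_of_manBits_le_two`), underflow / no window hit in the fat strip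
  (`drMul_of_underflow_of_embedsTest`, `drMul_of_mulWindowHit_eq_false`) and the `(3, 5)` column
  at `d ≥ 4` (`drMul_fine_three_five`).
* §2 THE NAMED MATRIX OFF THE HYPOTHESIS (kernel census, independent of §1): of the `67` embedded
  pairs of the `13` named records, `32` meet `mulRegisterHyp` (there the test IS the verdict,
  `mulRegisterTest_named_consistent`) and `35` do not (sources e2m1, e3m2, e2m3, binary8p5 are not
  deep); on those the test still equals the certified matrix `drMulPairs` on `30` and differs
  on exactly `5` — e2m1 → e3m2 / e2m3 / e5m2 / binary8p3 / binary8p3f, innocuous by exhaustion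
  of the `|F_e2m1|²` products (`E2M1_mul_via_precision3`, clause (E)) where the closed form
  answers ✗.
  Hence on all `67` embedded named pairs `mulRegisterTest ⇒ DRMul`
  (`mulRegisterTest_named_sound`, one kernel evaluation; `drMul_named_of_mulRegisterTest`, the
  same through §1) and the test is the verdict on `62` of them.

Implementation A: `code/enum/mul_register_sound.py` → certificate C47
`certs/enum/DOUBLE-ROUNDING-MUL-REGISTER-SOUND.json` (the named census above from the certified
matrix, and `test ⇒ DRMul` by brute force over all products of SHALLOW pseudo-records off the
hypothesis); `DOUBLE-ROUNDING-MUL.md` §16.  PLACEMENT: the innocuous double rounding criteria of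
[Figueroa1995, §3] and [Rump2016, Lemma 4.5] concern one operation in a wider format with
unbounded exponent; the statements here include gradual underflow and saturation of both formats.
No hardware or vendor claims.
-/

namespace Summit.Ventures.CertifiedArithmetic

open Literature.ComputerArithmetic.FloatingPoint
open Literature.ComputerArithmetic.FloatingPoint.Format
open Literature.ComputerArithmetic.FloatingPoint.MiniFloat

/-! ## §1 Soundness of the closed form for every source -/

/-- THEOREM D-mul-R⁺ (soundness, record-generic): `F_φ ⊆ F_ψ`, `m ≥ 1`, `2^m ≤ M_φ` and
`mulRegisterTest φ ψ` give `DRMul φ ψ` — by cases on the disjunct of the test that fires: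
`d = 0 ∧ m_ψ = m` (`drMul_of_equal_precision_sameQ`, `M_φ ≤ M_ψ` from the embedding),
`d = 0 ∧ m ≤ 2 < m_ψ` (`drMul_sameQ_strip_of_manBits_le_two`),
`d ≥ 2m + 2 ∧ m_ψ ≥ 2m + 1` (`drMul_of_underflow_of_embedsTest`),
`m + 2 ≤ d ≤ 2m + 1 ∧ m_ψ ≥ 2m + 1 ∧` no window hit (`drMul_of_mulWindowHit_eq_false`,
the only use of `2^m ≤ M_φ`), and `(m, m_ψ) = (2, 4) ∧ d ≥ 4` (`drMul_fine_three_five`).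
[this packet] -/
theorem drMul_of_mulRegisterTest {φ ψ : Format} (hE : embedsTest φ ψ = true)
    (h1 : 1 ≤ φ.manBits) (hN : 2 ^ φ.manBits ≤ φ.maxScaled)
    (ht : mulRegisterTest φ ψ = true) : DRMul φ ψ := by
  have hE' := hE
  simp only [embedsTest, Bool.and_eq_true, decide_eq_true_eq] at hE'
  obtain ⟨⟨hP, hq⟩, hMM⟩ := hE'
  simp only [mulRegisterTest, Bool.or_eq_true, Bool.and_eq_true, decide_eq_true_eq] at ht
  rcases ht with (⟨hq0, hm⟩ | ⟨⟨hd, hfat⟩, hl⟩) | ⟨⟨h4, hm⟩, hmψ⟩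
  · -- equal quanta
    rcases Nat.eq_or_lt_of_le hP with hPe | hPl
    · have h0 : (φ.qexp - ψ.qexp).toNat = 0 := by omega
      rw [h0, pow_zero, mul_one] at hMM
      exact drMul_of_equal_precision_sameQ hq0 hPe.symm h1 hMM
    · have h2 : φ.manBits ≤ 2 := by
        rcases hm with hm | hm
        · omega
        · exact hm
      exact drMul_sameQ_strip_of_manBits_le_two hE hq0 h1 (by omega) h2
  · -- the fat strip: underflow, or the gap with no window hit
    by_cases hU : ψ.qexp + (2 * φ.manBits + 2) ≤ φ.qexp
    · exact drMul_of_underflow_of_embedsTest hE h1 hfat (by omega)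
    · simp only [mulLawTest, Bool.or_eq_true, decide_eq_true_eq, Bool.and_eq_true,
        Bool.not_eq_true'] at hl
      rcases hl with hU' | ⟨hG, hhit⟩
      · exact absurd hU' hU
      · exact drMul_of_mulWindowHit_eq_false hE h1 hN hfat hG (by omega) hhit
  · -- the `(3, 5)` column at `d ≥ 4`
    exact drMul_fine_three_five hE hm hmψ h4

/-- The same with the source clauses as ONE Boolean:
`embedsTest φ ψ ∧ 1 ≤ m ∧ 2^m ≤ M_φ`. [this packet] -/
theorem drMul_of_mulRegisterTest' {φ ψ : Format}
    (h : (embedsTest φ ψ && decide (1 ≤ φ.manBits) &&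
      decide (2 ^ φ.manBits ≤ φ.maxScaled) && mulRegisterTest φ ψ) = true) : DRMul φ ψ := by
  simp only [Bool.and_eq_true, decide_eq_true_eq] at h
  obtain ⟨⟨⟨hE, h1⟩, hN⟩, ht⟩ := h
  exact drMul_of_mulRegisterTest hE h1 hN ht

/-! ## §2 The named matrix off the hypothesis -/

/-- Every named record has `m ≥ 1` and a normal binade (`2^m ≤ M`). [this packet] -/
theorem named_manBits_pos_normal :
    ∀ X ∈ namedFormats, 1 ≤ X.manBits ∧ 2 ^ X.manBits ≤ X.maxScaled := by
  decide +kernel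

/-- SOUNDNESS ON THE NAMED MATRIX THROUGH §1: an embedded named pair passing the closed-form
test double rounds products innocuously. [this packet] -/
theorem drMul_named_of_mulRegisterTest {X Y : Format} (hX : X ∈ namedFormats)
    (hE : embedsTest X Y = true) (ht : mulRegisterTest X Y = true) : DRMul X Y :=
  drMul_of_mulRegisterTest hE (named_manBits_pos_normal X hX).1
    (named_manBits_pos_normal X hX).2 ht

/-- THE EMBEDDED NAMED PAIRS: `67`, of which `35` are OFF the hypothesis `mulRegisterHyp` (and
`32` on it, `mulRegisterHyp_named_count`). [this packet] -/
theorem mulRegister_named_embedded_count :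
    (namedPairs.filter fun p => embedsTest p.1 p.2).length = 67 ∧
    (namedPairs.filter fun p => embedsTest p.1 p.2 && !mulRegisterHyp p.1 p.2).length = 35 := by
  decide +kernel

/-- OFF THE HYPOTHESIS THE TEST DIFFERS FROM THE CERTIFIED MATRIX ON EXACTLY FIVE PAIRS, all
with source e2m1 and all on the safe side (test ✗, verdict ✓ by exhaustion:
`E2M1_mul_via_precision3` and, for e2m3, clause (E)). [this packet] -/
theorem mulRegister_named_offhyp_differ :
    (namedPairs.filter fun p => embedsTest p.1 p.2 && !mulRegisterHyp p.1 p.2 &&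
        (mulRegisterTest p.1 p.2 != decide (p ∈ drMulPairs))) =
      [(E2M1, E3M2), (E2M1, E2M3), (E2M1, E5M2), (E2M1, Binary8p3), (E2M1, Binary8p3F)] := by
  decide +kernel

/-- SOUNDNESS ON THE NAMED MATRIX BY ONE KERNEL EVALUATION (independent of §1): on all `67`
embedded named pairs `mulRegisterTest ⇒ (X, Y) ∈ drMulPairs` (`⇔ DRMul X Y`,
`drMul_named_iff`). [this packet] -/
theorem mulRegisterTest_named_sound : ∀ X ∈ namedFormats, ∀ Y ∈ namedFormats,
    embedsTest X Y = true → mulRegisterTest X Y = true → (X, Y) ∈ drMulPairs := by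
  decide +kernel

/-- … and the test IS the verdict on `62` of the `67` (the `32` on the hypothesis and `30` of the
`35` off it). [this packet] -/
theorem mulRegisterTest_named_agree_count :
    (namedPairs.filter fun p => embedsTest p.1 p.2 &&
        (mulRegisterTest p.1 p.2 == decide (p ∈ drMulPairs))).length = 62 := by
  decide +kernel

/-- THE FIVE EXCEPTIONS HOLD (so the closed form under-approximates only): products of e2m1 data
double round innocuously through e3m2, e2m3, e5m2, binary8p3 and binary8p3f although
`mulRegisterTest` answers ✗ there (e2m1 has `bias = 1 < m + 3`). [this packet] -/
theorem drMul_e2m1_offhyp :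
    (mulRegisterTest E2M1 E3M2 = false ∧ DRMul E2M1 E3M2) ∧
    (mulRegisterTest E2M1 E2M3 = false ∧ DRMul E2M1 E2M3) ∧
    (mulRegisterTest E2M1 E5M2 = false ∧ DRMul E2M1 E5M2) ∧
    (mulRegisterTest E2M1 Binary8p3 = false ∧ DRMul E2M1 Binary8p3) ∧
    (mulRegisterTest E2M1 Binary8p3F = false ∧ DRMul E2M1 Binary8p3F) := by
  refine ⟨⟨by decide +kernel, ?_⟩, ⟨by decide +kernel, ?_⟩, ⟨by decide +kernel, ?_⟩,
    ⟨by decide +kernel, ?_⟩, ⟨by decide +kernel, ?_⟩⟩ <;>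
    exact (drMul_named_iff (by decide) (by decide)).2 (by decide +kernel)

end Summit.Ventures.CertifiedArithmetic
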